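/-
Copyright (c) 2026. All rights reserved.
Released under Apache 2.0 license as described in the file LICENSE.
Authors: HodgeCM publication cell (pub-hodgecm), GR lane, seat GR-2 (`pub-hodgecm-own-hyp34`).
-/
import Literature.NumberTheory.Weil1964.ArchMetaplecticExtension
import Literature.NumberTheory.Weil1964.AdelicMetaplecticGenerators
import Literature.Analysis.SegalBargmann.SchwartzLeviContinuity
import HarnessLib

/-!
# The Siegel–Levi section of `Mp^𝓢(ℝ^σ)` and its conjugates: continuous homomorphisms `GL_σ(ℝ) → Mp^𝓢(W)`

Topic `NumberTheory/Weil1964`; namespace `Literature.NumberTheory.Weil1964` (continues `ArchMetaplecticExtension`).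
KERNEL ONLY: definitions with bodies and theorems; no `def … : Prop` record, no `axiom`, no proof hole.

[Folland1989, §4.2 (4.24)]: in the Schrödinger model on `𝓢(ℝ^σ) ⊂ L²(ℝ^σ)` the Levi factor
`M = {m(A) = diag(A, A^{*-1})}` of the Siegel parabolic is implemented by `μ(m(A)) f(x) = |det A|^{-1/2} f(A⁻¹ x)`, and
"*`μ` restricted to `M` is an honest (not merely projective) representation*" ([Folland1989, remark after (4.25)];
[Kudla1996, Chap. I §2 Prop. 2.3]: `A(m(a))φ(x) = |det a|^{1/2} φ(xa)` — the row-vector form of the same operator;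
[Weil1964, Chap. I n° 13 p. 160]: `d₀` is a monomorphism).  For a DIFFERENT complete polarisation `g Y`, `g ∈ Sp(W)`,
the Levi of `P_{gY} = g P_Y g⁻¹` is implemented by the conjugates `x μ(m(A)) x⁻¹`, `x` any element of the
metaplectic group over `g` ([Kudla1996, Chap. I §2, Remark after Prop. 2.3]; [MoeglinVignerasWaldspurger1987,
Chap. 2 II.2]); since two lifts of `g` differ by a unimodular SCALAR (`MpS.exists_unitSmul_of_proj_eq`), the conjugate
does not depend on `x`.

WHAT IS HERE, for Folland's group `MpS σ` of `ArchMetaplecticExtension` (pairs `(g, S)`, `S` a topological automorphism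
of `𝓢(ℝ^σ)` implementing `g ∈ Sp(ℝ^σ × ℝ^σ, dotPairing)` and unitarily liftable):
* §1 `glEquiv_one/_mul` (the tree's `glEquiv : GL_σ → (ℝ^σ ≃ₗ ℝ^σ)` is a homomorphism), the contragredient
  `trInv a = (a⁻¹)ᵀ` of `AdelicMetaplecticGenerators` as a homomorphism (`trInvHom`) and its compatibility with
  `dotPairing` (`dotPairing_glEquiv_trInv`);
* §2 **`MpS.leviGL : GL_σ(ℝ) →* MpS σ`**, `a ↦ (m(a, (a⁻¹)ᵀ), f ↦ |det a|^{-1/2} f ∘ a⁻¹)` (the tree's `MpS.levi` /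
  `leviEquiv`, packaged as a HOMOMORPHISM by `leviS_mul`), `proj_leviGL`, `leviGL_apply_snd`, and its STRONG CONTINUITY
  along operator-norm-continuous families (`continuous_leviGL_snd_apply`, from `continuous_leviS_apply`), with the
  discharge of that hypothesis from entrywise continuity of `z ↦ (a z)⁻¹` (`continuous_symm_toCLM_of_continuous_inv`);
* §3 the unimodular scalars `MpS.unitScalar` are CENTRAL (`MpS.unitScalar_mem_center`), two elements over the same
  `g` differ by a central element (`MpS.inv_mul_mem_center_of_proj_eq`);
* §4 **`MpS.leviAlong x a : G →* MpS σ`**, `h ↦ x · leviGL (a h) · x⁻¹` for a homomorphism `a : G →* GL_σ(ℝ)` and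
  `x ∈ MpS σ`: over `h ↦ π(x) m(a h) π(x)⁻¹` (`proj_leviAlong`), INDEPENDENT of the lift `x` of `π(x)`
  (`leviAlong_eq_of_proj_eq`), with operator `S_x ∘ leviS(a h) ∘ S_x⁻¹` (`leviAlong_apply_snd`) and strongly
  continuous when `h ↦ (a h)⁻¹` is (`continuous_leviAlong_snd_apply`) — the archimedean counterpart of
  `AdelicSiegelParabolicLiftConj.adelicSiegelLiftConj`.

USE (recorded, nothing here depends on it): at a real place `v` of `F` split in the quadratic extension `E`, or at a
complex place, the unitary group `U(V)(F_v)` is conjugate into the Siegel Levi (`Automorphic/UnitaryGroupSymplecticSplitLevi`,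
`splitCayley_conj_toSymplectic`), so `leviAlong` gives its archimedean Weil section in Folland's model, to be fed to
`AdelicMetaplecticArchSection.archLift` (whose continuity hypothesis `hsc` is `continuous_leviAlong_snd_apply`).

## References
* [Folland1989] G. B. Folland, *Harmonic Analysis in Phase Space*, Ann. of Math. Stud. 122 (1989), §4.2 (4.24)–(4.25)
  and the remark following them.
* [Kudla1996] S. S. Kudla, *Notes on the local theta correspondence* (1996), Chap. I §2 Prop. 2.3 and Remark.
* [MoeglinVignerasWaldspurger1987] C. Mœglin, M.-F. Vignéras, J.-L. Waldspurger, LNM 1291 (1987), Chap. 2 II.1–II.2.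
* [Weil1964] A. Weil, Acta Math. 111 (1964), Chap. I n° 13 p. 160 (`d₀`).
-/

set_option autoImplicit false

noncomputable section

open Matrix
open Literature.RepresentationTheory.HeisenbergGroup
open Literature.RepresentationTheory.HeisenbergGroup.SymplecticMatrix
open Literature.Analysis.SegalBargmann

namespace Literature.NumberTheory.Weil1964

variable {σ : Type*} [Fintype σ] [DecidableEq σ]

/-! ## §1 `glEquiv` is a homomorphism; the contragredient for `dotPairing` -/

omit [Fintype σ] in
/-- `glEquiv 1 = 1`. [cite: Folland1989, §4.2 (4.24)] -/
theorem glEquiv_one {K : Type*} [CommRing K] [Fintype σ] : glEquiv (1 : GL σ K) = 1 :=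
  LinearEquiv.ext fun x => by rw [glEquiv_apply, Units.val_one, Matrix.one_mulVec, LinearEquiv.coe_one, id]

omit [Fintype σ] in
/-- `glEquiv (a b) = glEquiv a * glEquiv b`. [cite: Folland1989, §4.2 (4.24)] -/
theorem glEquiv_mul {K : Type*} [CommRing K] [Fintype σ] (a b : GL σ K) : glEquiv (a * b) = glEquiv a * glEquiv b :=
  LinearEquiv.ext fun x => by
    rw [glEquiv_apply, LinearEquiv.mul_apply, glEquiv_apply, glEquiv_apply, Units.val_mul, Matrix.mulVec_mulVec]

/-- the contragredient `trInv a = (a⁻¹)ᵀ` (`AdelicMetaplecticGenerators` §0) is a homomorphism: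
`((ab)⁻¹)ᵀ = (a⁻¹)ᵀ (b⁻¹)ᵀ`. [cite: Folland1989, §4.2 (4.24)] -/
theorem trInv_mul {K : Type*} [CommRing K] (a b : GL σ K) : trInv (a * b) = trInv a * trInv b :=
  Units.ext (by rw [coe_trInv, Units.val_mul, coe_trInv, coe_trInv, _root_.mul_inv_rev, Units.val_mul,
    Matrix.transpose_mul])

/-- `trInv 1 = 1`. [cite: Folland1989, §4.2 (4.24)] -/
theorem trInv_one {K : Type*} [CommRing K] : trInv (1 : GL σ K) = 1 :=
  Units.ext (by rw [coe_trInv, inv_one, Units.val_one, Matrix.transpose_one])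

/-- `trInv` as a monoid homomorphism `GL_σ(K) →* GL_σ(K)`. [cite: Folland1989, §4.2 (4.24)] -/
def trInvHom {K : Type*} [CommRing K] : GL σ K →* GL σ K where
  toFun := trInv
  map_one' := trInv_one
  map_mul' := trInv_mul

/-- **`⟨a x, (a⁻¹)ᵀ y⟩ = ⟨x, y⟩`**: the pair `(a, (a⁻¹)ᵀ)` preserves the dot pairing. [cite: Folland1989, §4.2 (4.24)] -/
theorem dotPairing_glEquiv_trInv (a : GL σ ℝ) (x y : σ → ℝ) :
    dotPairing σ (glEquiv a x) (glEquiv (trInv a) y) = dotPairing σ x y := by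
  rw [dotPairing_apply, dotPairing_apply, glEquiv_apply, glEquiv_apply, coe_trInv, Matrix.dotProduct_mulVec,
    Matrix.vecMul_transpose, Matrix.mulVec_mulVec, ← Units.val_mul, inv_mul_cancel, Units.val_one, Matrix.one_mulVec]

/-! ## §2 The Levi homomorphism `GL_σ(ℝ) →* Mp^𝓢(W)` -/

namespace MpS

/-- **the Levi element of `a ∈ GL_σ(ℝ)`**: `(m(a, (a⁻¹)ᵀ), f ↦ |det a|^{-1/2} f ∘ a⁻¹) ∈ Mp^𝓢(W)`.
[cite: Folland1989, §4.2 (4.24)] -/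
def leviGL (a : GL σ ℝ) : MpS σ :=
  levi (glEquiv a) (glEquiv (trInv a)) (dotPairing_glEquiv_trInv a)

/-- `proj (leviGL a) = m(a, (a⁻¹)ᵀ)`. [cite: Folland1989, §4.2 (4.24)] -/
@[simp] theorem proj_leviGL (a : GL σ ℝ) :
    proj (leviGL a) = leviSp (dotPairing σ) (glEquiv a) (glEquiv (trInv a)) (dotPairing_glEquiv_trInv a) := rfl

/-- `proj (leviGL a)` on vectors: `(x, y) ↦ (a x, (a⁻¹)ᵀ y)`. [cite: Folland1989, §4.2 (4.24)] -/
theorem coe_proj_leviGL_apply (a : GL σ ℝ) (p : (σ → ℝ) × (σ → ℝ)) :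
    ((proj (leviGL a) : symplecticGroup (polar (dotPairing σ))) : ((σ → ℝ) × (σ → ℝ)) ≃ₗ[ℝ] ((σ → ℝ) × (σ → ℝ))) p =
      ((a : Matrix σ σ ℝ) *ᵥ p.1, ((a⁻¹ : GL σ ℝ) : Matrix σ σ ℝ)ᵀ *ᵥ p.2) := by
  rw [proj_leviGL, coe_leviSp_apply, glEquiv_apply, glEquiv_apply, coe_trInv]

/-- the operator of `leviGL a` is Folland's `leviS (glEquiv a)`: `f ↦ |det a|^{-1/2} f ∘ a⁻¹`.
[cite: Folland1989, §4.2 (4.24)] -/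
@[simp] theorem leviGL_apply_snd (a : GL σ ℝ) (f : SchwartzMap (σ → ℝ) ℂ) :
    (leviGL a).1.2 f = leviS (glEquiv a) f := rfl

/-- `leviGL 1 = 1`. [cite: Folland1989, §4.2 (4.24)] -/
theorem leviGL_one : leviGL (1 : GL σ ℝ) = 1 := by
  refine Subtype.ext (Prod.ext (Subtype.ext (LinearEquiv.ext fun p => ?_))
    (ContinuousLinearEquiv.ext (funext fun f => ?_)))
  · show ((proj (leviGL (1 : GL σ ℝ)) : symplecticGroup (polar (dotPairing σ))) :
        ((σ → ℝ) × (σ → ℝ)) ≃ₗ[ℝ] ((σ → ℝ) × (σ → ℝ))) p = p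
    rw [coe_proj_leviGL_apply, inv_one, Units.val_one, Matrix.transpose_one, Matrix.one_mulVec, Matrix.one_mulVec]
  · show (leviGL (1 : GL σ ℝ)).1.2 f = f
    rw [leviGL_apply_snd, glEquiv_one, leviS_one, ContinuousLinearMap.id_apply]

/-- `leviGL (a b) = leviGL a * leviGL b` ("`μ|_M` is an honest representation"). [cite: Folland1989, §4.2 (4.24)–(4.25)] -/
theorem leviGL_mul (a b : GL σ ℝ) : leviGL (a * b) = leviGL a * leviGL b := by
  refine Subtype.ext (Prod.ext (Subtype.ext (LinearEquiv.ext fun p => ?_))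
    (ContinuousLinearEquiv.ext (funext fun f => ?_)))
  · show ((proj (leviGL (a * b)) : symplecticGroup (polar (dotPairing σ))) :
        ((σ → ℝ) × (σ → ℝ)) ≃ₗ[ℝ] ((σ → ℝ) × (σ → ℝ))) p =
      ((proj (leviGL a * leviGL b) : symplecticGroup (polar (dotPairing σ))) :
        ((σ → ℝ) × (σ → ℝ)) ≃ₗ[ℝ] ((σ → ℝ) × (σ → ℝ))) p
    rw [map_mul, Subgroup.coe_mul, LinearEquiv.mul_apply, coe_proj_leviGL_apply, coe_proj_leviGL_apply,
      coe_proj_leviGL_apply, Units.val_mul, _root_.mul_inv_rev, Units.val_mul, Matrix.transpose_mul,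
      Matrix.mulVec_mulVec, Matrix.mulVec_mulVec]
  · show (leviGL (a * b)).1.2 f = (leviGL a).1.2 ((leviGL b).1.2 f)
    rw [leviGL_apply_snd, leviGL_apply_snd, leviGL_apply_snd, glEquiv_mul, leviS_mul, ContinuousLinearMap.comp_apply]

/-- **`MpS.leviGLHom : GL_σ(ℝ) →* Mp^𝓢(W)`** — the Siegel–Levi SECTION of the archimedean metaplectic group, a genuine
homomorphism. [cite: Folland1989, §4.2 (4.24)–(4.25)] -/
def leviGLHom : GL σ ℝ →* MpS σ where
  toFun := leviGL
  map_one' := leviGL_one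
  map_mul' := leviGL_mul

/-- unfolding. [cite: Folland1989, §4.2 (4.24)] -/
@[simp] theorem leviGLHom_apply (a : GL σ ℝ) : leviGLHom a = leviGL a := rfl

/-- `π ∘ leviGLHom` on vectors. [cite: Folland1989, §4.2 (4.24)] -/
theorem coe_proj_leviGLHom_apply (a : GL σ ℝ) (p : (σ → ℝ) × (σ → ℝ)) :
    ((proj (leviGLHom a) : symplecticGroup (polar (dotPairing σ))) : ((σ → ℝ) × (σ → ℝ)) ≃ₗ[ℝ] ((σ → ℝ) × (σ → ℝ))) p =
      ((a : Matrix σ σ ℝ) *ᵥ p.1, ((a⁻¹ : GL σ ℝ) : Matrix σ σ ℝ)ᵀ *ᵥ p.2) :=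
  coe_proj_leviGL_apply a p

/-! ### Strong continuity of the Levi section -/

/-- matrices as continuous linear maps of `ℝ^σ`, an `ℝ`-linear map (hence continuous: finite dimension). [cite: Folland1989, §4.2 (4.24)] -/
def matrixToCLM : Matrix σ σ ℝ →ₗ[ℝ] ((σ → ℝ) →L[ℝ] (σ → ℝ)) :=
  (LinearMap.toContinuousLinearMap : ((σ → ℝ) →ₗ[ℝ] (σ → ℝ)) ≃ₗ[ℝ] ((σ → ℝ) →L[ℝ] (σ → ℝ))).toLinearMap ∘ₗ
    (Matrix.toLin' : Matrix σ σ ℝ ≃ₗ[ℝ] ((σ → ℝ) →ₗ[ℝ] (σ → ℝ))).toLinearMap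

/-- formula. [cite: Folland1989, §4.2 (4.24)] -/
@[simp] theorem matrixToCLM_apply (M : Matrix σ σ ℝ) (x : σ → ℝ) : matrixToCLM M x = M *ᵥ x := by
  simp only [matrixToCLM, LinearMap.coe_comp, LinearEquiv.coe_coe, Function.comp_apply,
    LinearMap.coe_toContinuousLinearMap', Matrix.toLin'_apply]

/-- `matrixToCLM` is continuous. [cite: Folland1989, §4.2 (4.24)] -/
theorem continuous_matrixToCLM : Continuous (matrixToCLM (σ := σ)) :=
  LinearMap.continuous_of_finiteDimensional _

/-- the inverse of `glEquiv a` as a continuous linear map is `matrixToCLM a⁻¹`. [cite: Folland1989, §4.2 (4.24)] -/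
theorem glEquiv_symm_toContinuousLinearEquiv_eq (a : GL σ ℝ) :
    (((glEquiv a).symm.toContinuousLinearEquiv : (σ → ℝ) ≃L[ℝ] (σ → ℝ)) : (σ → ℝ) →L[ℝ] (σ → ℝ)) =
      matrixToCLM ((a⁻¹ : GL σ ℝ) : Matrix σ σ ℝ) := by
  refine ContinuousLinearMap.ext fun x => ?_
  rw [matrixToCLM_apply]
  exact glEquiv_symm_apply a x

/-- **discharge of the operator-norm continuity hypothesis**: if `z ↦ (a z)⁻¹` is continuous entrywise (e.g. `a`
continuous into `GL_σ(ℝ)`), then `z ↦ (glEquiv (a z))⁻¹` is operator-norm continuous. [cite: Folland1989, §4.2 (4.24)] -/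
theorem continuous_symm_toCLM_of_continuous_inv {Z : Type*} [TopologicalSpace Z] {a : Z → GL σ ℝ}
    (ha : Continuous fun z => (((a z)⁻¹ : GL σ ℝ) : Matrix σ σ ℝ)) :
    Continuous fun z => (((glEquiv (a z)).symm.toContinuousLinearEquiv : (σ → ℝ) ≃L[ℝ] (σ → ℝ)) :
      (σ → ℝ) →L[ℝ] (σ → ℝ)) := by
  simp only [glEquiv_symm_toContinuousLinearEquiv_eq]
  exact continuous_matrixToCLM.comp ha

/-- a continuous map into `GL_σ(ℝ)` has entrywise continuous inverses. [cite: Folland1989, §4.2 (4.24)] -/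
theorem continuous_coe_inv_of_continuous {Z : Type*} [TopologicalSpace Z] {a : Z → GL σ ℝ} (ha : Continuous a) :
    Continuous fun z => (((a z)⁻¹ : GL σ ℝ) : Matrix σ σ ℝ) :=
  Units.continuous_coe_inv.comp ha

/-- **STRONG CONTINUITY of the Levi section along a family**: `z ↦ leviS(a z) f` is continuous in `𝓢(ℝ^σ)` when
`z ↦ (a z)⁻¹` is entrywise continuous (`continuous_leviS_apply`). [cite: Folland1989, §4.2 (4.24)] -/
theorem continuous_leviGL_snd_apply {Z : Type*} [TopologicalSpace Z] {a : Z → GL σ ℝ}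
    (ha : Continuous fun z => (((a z)⁻¹ : GL σ ℝ) : Matrix σ σ ℝ)) (f : SchwartzMap (σ → ℝ) ℂ) :
    Continuous fun z => (leviGL (a z)).1.2 f := by
  simp only [leviGL_apply_snd]
  exact continuous_leviS_apply (continuous_symm_toCLM_of_continuous_inv ha) f

/-! ## §3 The unimodular scalars are central; lifts of the same `g` differ centrally -/

omit [DecidableEq σ] in
/-- `unitScalar c` is CENTRAL in `Mp^𝓢(W)` (every `S` is `ℂ`-linear). [cite: MoeglinVignerasWaldspurger1987, Chap. 2 II.1 (B)] -/
theorem unitScalar_mem_center (c : ℂ) (hc : ‖c‖ = 1) : unitScalar (σ := σ) c hc ∈ Subgroup.center (MpS σ) := by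
  rw [Subgroup.mem_center_iff]
  intro x
  refine Subtype.ext (Prod.ext ?_ (ContinuousLinearEquiv.ext (funext fun f => ?_)))
  · show x.1.1 * (unitScalar c hc).1.1 = (unitScalar c hc).1.1 * x.1.1
    rw [show (unitScalar (σ := σ) c hc).1.1 = 1 from rfl, mul_one, one_mul]
  · show x.1.2 ((unitScalar c hc).1.2 f) = (unitScalar c hc).1.2 (x.1.2 f)
    rw [unitScalar_apply, unitScalar_apply, map_smul]

/-- **two elements of `Mp^𝓢(W)` over the same `g` differ by a CENTRAL element** (`x⁻¹ y` lies over `1`, hence is a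
unimodular scalar, `proj_eq_one_iff`). [cite: Folland1989, §4.2 (4.23); MoeglinVignerasWaldspurger1987, Chap. 2 II.1 (B)] -/
theorem inv_mul_mem_center_of_proj_eq {x y : MpS σ} (h : proj x = proj y) : x⁻¹ * y ∈ Subgroup.center (MpS σ) := by
  have hk : proj (x⁻¹ * y) = 1 := by rw [map_mul, map_inv, h, inv_mul_cancel]
  obtain ⟨c, hc, hxy⟩ := (proj_eq_one_iff _).1 hk
  rw [hxy]
  exact unitScalar_mem_center c hc

/-! ## §4 Conjugates of the Levi section: `h ↦ x · leviGL(a h) · x⁻¹` -/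

section Along

variable {G : Type*} [Group G]

/-- **`MpS.leviAlong x a : G →* Mp^𝓢(W)`**, `h ↦ x · leviGL (a h) · x⁻¹` — the Levi section of the polarisation `π(x) Y`
pulled back along a homomorphism `a : G →* GL_σ(ℝ)`. [cite: Kudla1996, Chap. I §2 Prop. 2.3 and Remark] -/
def leviAlong (x : MpS σ) (a : G →* GL σ ℝ) : G →* MpS σ :=
  (MulAut.conj x).toMonoidHom.comp (leviGLHom.comp a)

/-- formula. [cite: Kudla1996, Chap. I §2 Prop. 2.3 and Remark] -/
theorem leviAlong_apply (x : MpS σ) (a : G →* GL σ ℝ) (h : G) : leviAlong x a h = x * leviGL (a h) * x⁻¹ := rfl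

/-- `π(leviAlong x a h) = π(x) · m(a h) · π(x)⁻¹`. [cite: Kudla1996, Chap. I §2 Prop. 2.3 and Remark] -/
theorem proj_leviAlong (x : MpS σ) (a : G →* GL σ ℝ) (h : G) :
    proj (leviAlong x a h) = proj x * proj (leviGL (a h)) * (proj x)⁻¹ := by
  rw [leviAlong_apply, map_mul, map_mul, map_inv]

/-- the operator of `leviAlong x a h` is `S_x ∘ leviS(a h) ∘ S_x⁻¹`. [cite: Kudla1996, Chap. I §2 Prop. 2.3 and Remark] -/
theorem leviAlong_apply_snd (x : MpS σ) (a : G →* GL σ ℝ) (h : G) (f : SchwartzMap (σ → ℝ) ℂ) :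
    (leviAlong x a h).1.2 f = x.1.2 (leviS (glEquiv (a h)) (x.1.2.symm f)) := rfl

/-- **INDEPENDENCE OF THE LIFT**: `leviAlong x a = leviAlong y a` whenever `π(x) = π(y)`.
[cite: MoeglinVignerasWaldspurger1987, Chap. 2 II.1 (B); Kudla1996, Chap. I §2 Remark] -/
theorem leviAlong_eq_of_proj_eq {x y : MpS σ} (hxy : proj x = proj y) (a : G →* GL σ ℝ) :
    leviAlong y a = leviAlong x a := by
  ext h : 1
  have hz := Subgroup.mem_center_iff.1 (inv_mul_mem_center_of_proj_eq hxy) (leviGL (a h))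
  have hy : y = x * (x⁻¹ * y) := (mul_inv_cancel_left x y).symm
  rw [leviAlong_apply, leviAlong_apply, hy]
  calc x * (x⁻¹ * y) * leviGL (a h) * (x * (x⁻¹ * y))⁻¹
      = x * ((x⁻¹ * y) * leviGL (a h)) * ((x⁻¹ * y)⁻¹ * x⁻¹) := by simp only [mul_assoc, _root_.mul_inv_rev]
    _ = x * (leviGL (a h) * (x⁻¹ * y)) * ((x⁻¹ * y)⁻¹ * x⁻¹) := by rw [hz]
    _ = x * leviGL (a h) * x⁻¹ := by simp only [mul_assoc, mul_inv_cancel_left]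

/-- **STRONG CONTINUITY of `leviAlong`**: for a topological group `G` and `a` with `h ↦ (a h)⁻¹` entrywise continuous,
every orbit map `h ↦ S_{leviAlong x a h} f` is continuous in `𝓢(ℝ^σ)` — the hypothesis `hsc` of
`AdelicMetaplecticArchSection.continuous_archLift`. [cite: Folland1989, §4.2 (4.24); Weil1964, Chap. III n° 39 p. 189] -/
theorem continuous_leviAlong_snd_apply [TopologicalSpace G] (x : MpS σ) (a : G →* GL σ ℝ)
    (ha : Continuous fun h => (((a h)⁻¹ : GL σ ℝ) : Matrix σ σ ℝ)) (f : SchwartzMap (σ → ℝ) ℂ) :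
    Continuous fun h => (leviAlong x a h).1.2 f := by
  simp only [leviAlong_apply_snd]
  have h1 : Continuous fun h => leviS (glEquiv (a h)) (x.1.2.symm f) := by
    have := continuous_leviGL_snd_apply ha (x.1.2.symm f)
    simpa only [leviGL_apply_snd] using this
  exact x.1.2.continuous.comp h1

/-- the same from continuity of `a` itself into `GL_σ(ℝ)`. [cite: Folland1989, §4.2 (4.24)] -/
theorem continuous_leviAlong_snd_apply_of_continuous [TopologicalSpace G] (x : MpS σ) (a : G →* GL σ ℝ)
    (ha : Continuous a) (f : SchwartzMap (σ → ℝ) ℂ) : Continuous fun h => (leviAlong x a h).1.2 f :=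
  continuous_leviAlong_snd_apply x a (continuous_coe_inv_of_continuous ha) f

/-- continuity of the `π`-orbit maps of `leviAlong`: `h ↦ π(leviAlong x a h) w = π(x) (m(a h) (π(x)⁻¹ w))` is continuous
when `a` and `h ↦ (a h)⁻¹` are entrywise continuous. [cite: Weil1964, Chap. III n° 39 p. 189] -/
theorem continuous_proj_leviAlong_apply [TopologicalSpace G] (x : MpS σ) (a : G →* GL σ ℝ)
    (ha : Continuous fun h => ((a h : GL σ ℝ) : Matrix σ σ ℝ))
    (ha' : Continuous fun h => (((a h)⁻¹ : GL σ ℝ) : Matrix σ σ ℝ)) (w : (σ → ℝ) × (σ → ℝ)) :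
    Continuous fun h => ((proj (leviAlong x a h) : symplecticGroup (polar (dotPairing σ))) :
      ((σ → ℝ) × (σ → ℝ)) ≃ₗ[ℝ] ((σ → ℝ) × (σ → ℝ))) w := by
  have hrew : ∀ h, ((proj (leviAlong x a h) : symplecticGroup (polar (dotPairing σ))) :
        ((σ → ℝ) × (σ → ℝ)) ≃ₗ[ℝ] ((σ → ℝ) × (σ → ℝ))) w =
      ((proj x : symplecticGroup (polar (dotPairing σ))) : ((σ → ℝ) × (σ → ℝ)) ≃ₗ[ℝ] ((σ → ℝ) × (σ → ℝ)))
        (((a h : GL σ ℝ) : Matrix σ σ ℝ) *ᵥ (((proj x : symplecticGroup (polar (dotPairing σ))) :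
            ((σ → ℝ) × (σ → ℝ)) ≃ₗ[ℝ] ((σ → ℝ) × (σ → ℝ))).symm w).1,
          ((a h)⁻¹ : GL σ ℝ).1ᵀ *ᵥ (((proj x : symplecticGroup (polar (dotPairing σ))) :
            ((σ → ℝ) × (σ → ℝ)) ≃ₗ[ℝ] ((σ → ℝ) × (σ → ℝ))).symm w).2) := by
    intro h
    rw [proj_leviAlong, Subgroup.coe_mul, Subgroup.coe_mul, Subgroup.coe_inv, LinearEquiv.mul_apply,
      LinearEquiv.mul_apply, LinearEquiv.coe_inv, coe_proj_leviGL_apply]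
  simp only [hrew]
  refine ((proj x : symplecticGroup (polar (dotPairing σ))) : ((σ → ℝ) × (σ → ℝ)) ≃ₗ[ℝ]
    ((σ → ℝ) × (σ → ℝ))).toContinuousLinearEquiv.continuous.comp ?_
  refine Continuous.prodMk ?_ ?_
  · exact Continuous.matrix_mulVec ha continuous_const
  · exact Continuous.matrix_mulVec (Continuous.matrix_transpose ha') continuous_const

end Along

end MpS

end Literature.NumberTheory.Weil1964

end
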